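import Literature.NumberTheory.Sieve.VinogradovExpSumTools
import Literature.NumberTheory.Sieve.FejerKernelCounting
import HarnessLib

/-!
# Heath-Brown 2001 (PLMS), Lemma 10, summation step: `∑_{(q,k)} min{U, 1/(2‖mk/q‖)}` over a family
# of pairs with few members in each class `mk ≡ d' (mod q)`

Topic `Literature/NumberTheory/Sieve`; a PROVED combinatorial layer (definitions with bodies, no named
facts) under the named fact `Irving2015_largestPrimeFactor_cubic` (`LargestPrimeFactorCubic.lean`), third
input of Heath-Brown's **Lemma 10** (after `…RootPairs`, `…SawCount`).  Source: D. R. Heath-Brown,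
*The largest prime factor of `X³ + 2`*, Proc. London Math. Soc. (3) 82 (2001) 554–596, §7 p. 24 of the
held text: the error terms of (7.2) are summed over the ideals `R` by grouping according to the residue
`d` with `R ∣ d + c∛2` — "`≪ Q ∑_{0<|c|,|d|≤Q} |cd|⁻¹ #{N(R) ≤ Q : R ∣ d + c∛2} ≪ Q ∑ |cd|⁻¹ Q^ε ≪
Q^{1+2ε}`" and, for `c = 0`, "`≪ U ∑_{0<|d|≤Q} |d|⁻¹ #{N(R) ≤ Q : R ∣ d} ≪ UQ^ε`".

Abstract form PROVED here (pairs `(q, k)` of naturals, `1 ≤ q ≤ Q`, any integer `m`): if every class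
`{(q,k) ∈ P : q ∣ mk − d'}` (`d' ∈ ℤ`, `(m, d') ≠ (0,0)`) has at most `K` members, then

  **`sum_pairs_geomBound_le`**: `∑_{(q,k)∈P} min{U, 1/(2‖mk/q‖)} ≤ K (U + Q ∑_{i=1}^{Q} 1/i)`,

and `sum_pairs_geomBound_le_of_Icc` (class bound needed only for `|d'| ≤ Q`),
by sending `(q, k)` to the centred residue `d'` of `mk (mod q)` (`cres`), for which `‖mk/q‖ = |d'|/q`
(`distInt_div_eq`), so that `min{U, 1/(2‖mk/q‖)} ≤ U` if `d' = 0` and `≤ Q/(2|d'|)` otherwise.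

## References

* D. R. Heath-Brown, *The largest prime factor of `X³ + 2`*, Proc. London Math. Soc. (3) 82 (2001)
  554–596, §7 p. 24. [`HeathBrown2001LargestPrimeFactorCubic`]

## Mathlib / tree search

Tree: `Vinogradov.distInt`, `distInt_add_int`, `distInt_neg`, `geomBound`, `geomBound_le`,
`geomBound_le_inv`, `geomBound_nonneg` (`VinogradovExpSumTools`), `FejerCounting.distInt_eq_self`
(`FejerKernelCounting`).  Mathlib: `Int.emod_emod_of_dvd`, `Int.emod_nonneg`, `Int.emod_lt_of_pos`,
`Finset.sum_fiberwise_of_maps_to`.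
-/

noncomputable section

open Finset Real

namespace Literature.NumberTheory.Sieve.HeathBrown2001

open Literature.NumberTheory.Sieve.Vinogradov (distInt distInt_nonneg distInt_add_int distInt_neg geomBound
  geomBound_le geomBound_le_inv geomBound_nonneg)
open Literature.NumberTheory.Sieve.FejerCounting (distInt_eq_self)

/-! ### Centred residues -/

/-- The centred residue of `x` modulo `q ≥ 1`: the `d' ≡ x (mod q)` with `−q/2 < d' ≤ q/2`. [folklore] -/
def cres (q : ℕ) (x : ℤ) : ℤ := if 2 * (x % q) ≤ q then x % q else x % q - q

/-- `q ∣ x − cres q x`. [folklore] -/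
theorem dvd_sub_cres (q : ℕ) (x : ℤ) : (q : ℤ) ∣ x - cres q x := by
  unfold cres
  split_ifs with h2
  · exact Int.dvd_self_sub_emod
  · rw [show x - (x % q - q) = (x - x % q) + q by ring]
    exact dvd_add Int.dvd_self_sub_emod (dvd_refl _)

/-- `2|cres q x| ≤ q` for `q ≥ 1`. [folklore] -/
theorem two_mul_abs_cres_le {q : ℕ} (hq : 0 < q) (x : ℤ) : 2 * |cres q x| ≤ q := by
  have hq' : (0 : ℤ) < q := by exact_mod_cast hq
  have h0 : 0 ≤ x % q := Int.emod_nonneg _ hq'.ne'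
  have h1 : x % q < q := Int.emod_lt_of_pos _ hq'
  unfold cres
  split_ifs with h2
  · rw [abs_of_nonneg h0]; exact h2
  · rw [abs_of_neg (by linarith)]; linarith

/-- `|cres q x| ≤ Q` when `q ≤ Q`. [folklore] -/
theorem abs_cres_le {q Q : ℕ} (hq : 0 < q) (hqQ : q ≤ Q) (x : ℤ) : |cres q x| ≤ Q := by
  have := two_mul_abs_cres_le hq x
  have hqQ' : (q : ℤ) ≤ Q := by exact_mod_cast hqQ
  linarith [abs_nonneg (cres q x)]

/-- **`‖x/q‖ = |cres q x|/q`** for `q ≥ 1`. [folklore] -/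
theorem distInt_div_eq {q : ℕ} (hq : 0 < q) (x : ℤ) : distInt ((x : ℝ) / q) = |(cres q x : ℝ)| / q := by
  have hq' : (0 : ℝ) < q := by exact_mod_cast hq
  obtain ⟨n, hn⟩ := dvd_sub_cres q x
  have hx : (x : ℝ) / q = (cres q x : ℝ) / q + (n : ℝ) := by
    have : (x : ℝ) = cres q x + (q : ℝ) * n := by
      have := congr_arg (fun z : ℤ => (z : ℝ)) (show x = cres q x + q * n by linarith [hn])
      push_cast at this; exact this
    rw [this]; field_simp
  rw [hx, distInt_add_int]
  have hb := two_mul_abs_cres_le hq x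
  have hb' : |(cres q x : ℝ)| / q ≤ 1 / 2 := by
    rw [div_le_div_iff₀ hq' two_pos]
    have : (2 : ℝ) * |(cres q x : ℝ)| ≤ q := by
      rw [← Int.cast_abs]; exact_mod_cast hb
    linarith
  rcases le_or_gt 0 (cres q x : ℝ) with h0 | h0
  · rw [abs_of_nonneg h0] at hb' ⊢
    exact distInt_eq_self (div_nonneg h0 hq'.le) hb'
  · rw [abs_of_neg h0] at hb' ⊢
    rw [← distInt_neg, show -((cres q x : ℝ) / q) = -(cres q x : ℝ) / q by ring]
    exact distInt_eq_self (div_nonneg (by linarith) hq'.le) hb'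

/-! ### The bound for one pair and the summation -/

/-- The weight of a class: `U` for `d' = 0`, `Q/(2|d'|)` otherwise. [folklore] -/
def classWeight (U Q : ℕ) (d' : ℤ) : ℝ := if d' = 0 then U else (Q : ℝ) / (2 * |(d' : ℝ)|)

/-- `classWeight ≥ 0`. [folklore] -/
theorem classWeight_nonneg (U Q : ℕ) (d' : ℤ) : 0 ≤ classWeight U Q d' := by
  unfold classWeight; split_ifs <;> positivity

/-- **One pair**: `min{U, 1/(2‖mk/q‖)} ≤ classWeight(cres q (mk))` for `1 ≤ q ≤ Q`.
[cite: HeathBrown2001LargestPrimeFactorCubic, §7 p. 24] -/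
theorem geomBound_le_classWeight {q Q : ℕ} (hq : 0 < q) (hqQ : q ≤ Q) (U : ℕ) (m : ℤ) (k : ℕ) :
    geomBound U ((m : ℝ) * k / q) ≤ classWeight U Q (cres q (m * k)) := by
  have hq' : (0 : ℝ) < q := by exact_mod_cast hq
  have hx : ((m : ℝ) * k / q) = (((m * k : ℤ)) : ℝ) / q := by push_cast; ring
  unfold classWeight
  split_ifs with hd
  · exact geomBound_le _ _
  · have hdist : distInt ((m : ℝ) * k / q) = |(cres q (m * k) : ℝ)| / q := by rw [hx, distInt_div_eq hq]
    have hd' : (0 : ℝ) < |(cres q (m * k) : ℝ)| := by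
      rw [abs_pos]; exact_mod_cast hd
    have hpos : 0 < distInt ((m : ℝ) * k / q) := by rw [hdist]; positivity
    calc geomBound U ((m : ℝ) * k / q) ≤ 1 / (2 * distInt ((m : ℝ) * k / q)) := geomBound_le_inv _ hpos
      _ = (q : ℝ) / (2 * |(cres q (m * k) : ℝ)|) := by rw [hdist]; field_simp
      _ ≤ (Q : ℝ) / (2 * |(cres q (m * k) : ℝ)|) := by
          gcongr

/-- `∑_{d' ∈ [−Q, Q]} classWeight(d') = U + Q ∑_{i=1}^{Q} 1/i`. [folklore] -/
theorem sum_classWeight (U Q : ℕ) :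
    ∑ d' ∈ Icc (-(Q : ℤ)) Q, classWeight U Q d' = U + (Q : ℝ) * ∑ i ∈ Icc 1 Q, (1 : ℝ) / i := by
  -- split `[−Q, Q] = [−Q, −1] ∪ {0} ∪ [1, Q]`
  have hsplit : Icc (-(Q : ℤ)) Q = (Icc (-(Q : ℤ)) (-1) ∪ {0}) ∪ Icc (1 : ℤ) Q := by
    ext d; simp only [mem_union, mem_Icc, mem_singleton]; omega
  have hd1 : Disjoint (Icc (-(Q : ℤ)) (-1) ∪ {0}) (Icc (1 : ℤ) Q) := by
    rw [disjoint_left]; intro d hd hd'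
    simp only [mem_union, mem_Icc, mem_singleton] at hd hd'; omega
  have hd2 : Disjoint (Icc (-(Q : ℤ)) (-1)) ({0} : Finset ℤ) := by
    rw [disjoint_left]; intro d hd hd'
    simp only [mem_Icc, mem_singleton] at hd hd'; omega
  rw [hsplit, sum_union hd1, sum_union hd2, sum_singleton]
  have h0 : classWeight U Q 0 = U := by simp [classWeight]
  -- the positive part
  have hpos : ∑ d' ∈ Icc (1 : ℤ) Q, classWeight U Q d' = (Q : ℝ) / 2 * ∑ i ∈ Icc 1 Q, (1 : ℝ) / i := by
    rw [mul_sum]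
    have : Icc (1 : ℤ) Q = (Icc 1 Q).map Nat.castEmbedding := by
      ext d; simp only [mem_Icc, mem_map, Nat.castEmbedding_apply]
      constructor
      · intro h; exact ⟨d.toNat, by omega, by omega⟩
      · rintro ⟨i, hi, rfl⟩; exact ⟨by exact_mod_cast hi.1, by exact_mod_cast hi.2⟩
    rw [this, sum_map]
    refine sum_congr rfl fun i hi => ?_
    rw [mem_Icc] at hi
    have hi0 : (i : ℤ) ≠ 0 := by omega
    simp only [Nat.castEmbedding_apply, classWeight, if_neg hi0, Int.cast_natCast, Nat.abs_cast]
    field_simp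
  -- the negative part, by `d ↦ −d`
  have hneg : ∑ d' ∈ Icc (-(Q : ℤ)) (-1), classWeight U Q d' = ∑ d' ∈ Icc (1 : ℤ) Q, classWeight U Q d' := by
    have : Icc (-(Q : ℤ)) (-1) = (Icc (1 : ℤ) Q).map (Equiv.neg ℤ).toEmbedding := by
      ext d; simp only [mem_Icc, mem_map, Equiv.toEmbedding_apply, Equiv.neg_apply]
      constructor
      · intro h; exact ⟨-d, by omega, by omega⟩
      · rintro ⟨i, hi, rfl⟩; omega
    rw [this, sum_map]
    refine sum_congr rfl fun d hd => ?_
    rw [mem_Icc] at hd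
    simp only [Equiv.toEmbedding_apply, Equiv.neg_apply, classWeight, neg_eq_zero,
      if_neg (show d ≠ 0 by omega), Int.cast_neg, abs_neg]
  rw [hneg, hpos, h0]
  ring

/-- **Summation over the pairs**: if `1 ≤ q ≤ Q` on `P` and each class `{(q,k) ∈ P : q ∣ mk − d'}`
(`d' ∈ ℤ`) has at most `K` members, then
`∑_{(q,k)∈P} min{U, 1/(2‖mk/q‖)} ≤ K (U + Q ∑_{i=1}^{Q} 1/i)`.
[cite: HeathBrown2001LargestPrimeFactorCubic, §7 p. 24] -/
theorem sum_pairs_geomBound_le (P : Finset (Σ _ : ℕ, ℕ)) {Q : ℕ}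
    (hP : ∀ qk ∈ P, 0 < qk.1 ∧ qk.1 ≤ Q) (U : ℕ) {m : ℤ} {K : ℝ}
    (hcount : ∀ d' : ℤ, (#(P.filter fun qk => ((qk.1 : ℕ) : ℤ) ∣ m * qk.2 - d') : ℝ) ≤ K) :
    ∑ qk ∈ P, geomBound U ((m : ℝ) * qk.2 / qk.1) ≤ K * (U + (Q : ℝ) * ∑ i ∈ Icc 1 Q, (1 : ℝ) / i) := by
  classical
  set g : (Σ _ : ℕ, ℕ) → ℤ := fun qk => cres qk.1 (m * qk.2) with hg
  have hmaps : ∀ qk ∈ P, g qk ∈ Icc (-(Q : ℤ)) Q := by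
    intro qk hqk
    obtain ⟨h1, h2⟩ := hP qk hqk
    rw [mem_Icc, ← abs_le]
    exact abs_cres_le h1 h2 _
  rw [← sum_fiberwise_of_maps_to hmaps, ← sum_classWeight, mul_sum]
  refine sum_le_sum fun d' _ => ?_
  -- on the fibre `g = d'`: each term `≤ classWeight d'`, and the fibre lies in the class `q ∣ mk − d'`
  calc ∑ qk ∈ P.filter (fun qk => g qk = d'), geomBound U ((m : ℝ) * qk.2 / qk.1)
      ≤ ∑ _qk ∈ P.filter (fun qk => g qk = d'), classWeight U Q d' := by
        refine sum_le_sum fun qk hqk => ?_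
        rw [mem_filter] at hqk
        obtain ⟨h1, h2⟩ := hP qk hqk.1
        have := geomBound_le_classWeight h1 h2 U m qk.2
        rwa [show cres qk.1 (m * qk.2) = d' from hqk.2] at this
    _ = #(P.filter fun qk => g qk = d') * classWeight U Q d' := by rw [sum_const, nsmul_eq_mul]
    _ ≤ #(P.filter fun qk => ((qk.1 : ℕ) : ℤ) ∣ m * qk.2 - d') * classWeight U Q d' := by
        gcongr with qk hqk
        · exact classWeight_nonneg _ _ _
        · intro hg'
          rw [← hg']
          exact dvd_sub_cres _ _
    _ ≤ K * classWeight U Q d' := by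
        gcongr
        · exact classWeight_nonneg _ _ _
        · exact hcount d'

/-- **Summation over the pairs, classes `|d'| ≤ Q` only**: as `sum_pairs_geomBound_le`, but the class
bound `≤ K` is required only for the centred residues that occur, `d' ∈ [−Q, Q]`.
[cite: HeathBrown2001LargestPrimeFactorCubic, §7 p. 24] -/
theorem sum_pairs_geomBound_le_of_Icc (P : Finset (Σ _ : ℕ, ℕ)) {Q : ℕ}
    (hP : ∀ qk ∈ P, 0 < qk.1 ∧ qk.1 ≤ Q) (U : ℕ) {m : ℤ} {K : ℝ}
    (hcount : ∀ d' ∈ Icc (-(Q : ℤ)) Q, (#(P.filter fun qk => ((qk.1 : ℕ) : ℤ) ∣ m * qk.2 - d') : ℝ) ≤ K) :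
    ∑ qk ∈ P, geomBound U ((m : ℝ) * qk.2 / qk.1) ≤ K * (U + (Q : ℝ) * ∑ i ∈ Icc 1 Q, (1 : ℝ) / i) := by
  classical
  set g : (Σ _ : ℕ, ℕ) → ℤ := fun qk => cres qk.1 (m * qk.2) with hg
  have hmaps : ∀ qk ∈ P, g qk ∈ Icc (-(Q : ℤ)) Q := by
    intro qk hqk
    obtain ⟨h1, h2⟩ := hP qk hqk
    rw [mem_Icc, ← abs_le]
    exact abs_cres_le h1 h2 _
  rw [← sum_fiberwise_of_maps_to hmaps, ← sum_classWeight, mul_sum]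
  refine sum_le_sum fun d' hd' => ?_
  calc ∑ qk ∈ P.filter (fun qk => g qk = d'), geomBound U ((m : ℝ) * qk.2 / qk.1)
      ≤ ∑ _qk ∈ P.filter (fun qk => g qk = d'), classWeight U Q d' := by
        refine sum_le_sum fun qk hqk => ?_
        rw [mem_filter] at hqk
        obtain ⟨h1, h2⟩ := hP qk hqk.1
        have := geomBound_le_classWeight h1 h2 U m qk.2
        rwa [show cres qk.1 (m * qk.2) = d' from hqk.2] at this
    _ = #(P.filter fun qk => g qk = d') * classWeight U Q d' := by rw [sum_const, nsmul_eq_mul]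
    _ ≤ #(P.filter fun qk => ((qk.1 : ℕ) : ℤ) ∣ m * qk.2 - d') * classWeight U Q d' := by
        gcongr with qk hqk
        · exact classWeight_nonneg _ _ _
        · intro hg'
          rw [← hg']
          exact dvd_sub_cres _ _
    _ ≤ K * classWeight U Q d' := by
        gcongr
        · exact classWeight_nonneg _ _ _
        · exact hcount d' hd'

-- `∑_{i=1}^{Q} 1/i ≤ 1 + log Q` is the tree's `Shiu.sum_Icc_inv_le_one_add_log` (`ShiuTheoremProofs`).

end Literature.NumberTheory.Sieve.HeathBrown2001
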